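import Summits.QuantumFields.YangMills.Theorems.BalabanUVNodesN15CovariantLandauTwoGridDefectRowExp
import Summits.QuantumFields.YangMills.Theorems.BalabanUVNodesN15TwoSpacingGluingCurvedKnitCovariantLandauGlobalRowsFromDefect
import Summits.QuantumFields.YangMills.Theorems.BalabanUVNodesN15TwoSpacingGluingCurvedKnitCovariantLandauFlatRowsAtIndex
import Summits.QuantumFields.YangMills.Theorems.BalabanUVNodesN15TwoSpacingGluingCurvedKnitCovariantAveragingTransfer
import Summits.QuantumFields.YangMills.Theorems.BalabanUVNodesN15TwoSpacingGluingCurvedKnitCovariantAveragingNode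
import HarnessLib

/-!
# Route «BalabanUVNodes», node N15 = NE2, road (c) — PROGRAMME (P-S), L: ★★★★ THE LANDAU-DEFECT ROW `hD` OF n15-c∕234 PROVED AT EVERY INDEX (`landauDefectRow_sfqr`), HENCE THE NODE
# THEOREM 234′ FROM THE ENTRIES ALONE (`ne2PlusOperator_sfqr_of_entries`) AND — with dag-n15-a (♭-8a) — `NE2PlusOperator` FOR THE (P-R) KNIT FAMILY WITH ALL FOUR ENTRIES CONCRETE AND
# NO DISPLAYED ROW (`ne2PlusOperator_sfqr₄E_closed`) (dag-n15-c g25, n15-c∕257)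

Cell `pub-ymgap`, seat `pub-ymgap-dag-n15-c` (generation g25; R134 (a), s1; HUMAN RULING D-0062; chair R424 venue).  `bears_on: R4∕N15 · K3⁸ SpineGivenEndpointR13SepCoPHV
(stmt-QuantumFields-27366)`; filed `--supports stmt-QuantumFields-27366 --as helper` — COUNT-NEUTRAL.  Four theorems; 0 `sorry`.  Generator `tools/g25/gen257.py`.  Nothing in the tree is modified.

WHAT THIS FILE PROVES (kernel).  (1) `abs_aK_add_sub_aK_le`: King's couplings at two scales differ by `|a_{r+k} − a_k| ≤ 2·(L^k)⁻¹` (`L ≥ 2`, `k ≥ 1`).  (2) ★★★ `landauDefectRow_sfqr`: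
for `L ≥ 7` odd, any mass `a > 0` and any `c35 > 0`, the hypothesis `hD` of n15-c∕234 — the two-grid η-defect row of the Landau letter `N_V^R` at the knit's exponential transporters
`U′ = e^{A′∕n′}`, `U = e^{Ā∕n}` (`Ā` = King block mean), `HasMaj (CvNorm …) (…) (idef P̂_V P̂_V (cvNVr′ … U′) (cvNVr … U)) ((C_R·(L^k)^{−γ_R})·e^{−δ_D d})` at every index `i` and every
class field `A′ ∈ Reg335 c35 α₀` in the window `L^m·α₀ ≤ a_D` — with ONE constant block `(δ_D, C_R, γ_R, a_D) = (3δ∕16, max 0 K, 1∕4, 1∕(c35·Θ))`.  Per index: (3.35)'s class gives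
the sizes `‖A′‖ ≤ r := c35·L^m·α₀`, `‖∇A′‖ ≤ r∕n′`, `‖∇∇A′‖ ≤ r∕n′²` (Frobenius ⟹ operator norm); dag-n15-a's `flatRowsAll_sfIdx` (γ = 1∕4) gives the fourteen flat rows with one
constant block `(C, δ, C_S)` at King's masses `a_k·n^{d+1}` (windows `1∕2 ≤ a_k ≤ 1`, to which the letters are moved by n15-c∕210's mass freedom); (1) gives `|a_{r+k} − a_k| ≤
2·(L^k)^{−1∕4}`; the window gives the smallness `r·Θ ≤ 1` for the INDEX-FREE threshold `Θ` of n15-c∕256; and n15-c∕256 `hasMaj_idef_landauCov_sub_landauRe_exp` (at `M := cvM`,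
`S := (L^k)^{−1∕4}`) yields the row with majorant `(L^k)^{−1∕4}·K·e^{−(3δ∕16)d}`, `K` index-free (obtained by unification, recorded as `max 0 K`).  (3) ★★★ `ne2PlusOperator_sfqr_of_entries`
= n15-c∕234 ∘ (2): `NE2PlusOperator c35 (sfInstance d mm ι hL) (sfqrFamily … (E ·))` displaying ONLY the η-rate rows `hE` of the entries `n = 1, 2, 3` of an arbitrary entry family `E`.
(4) ★★★★ `ne2PlusOperator_sfqr₄E_closed` = dag-n15-a (♭-8a) `ne2PlusOperator_sfqr₄E_of_defectRow` ∘ (2): `NE2PlusOperator c35 (sfInstance d mm ι hL) (sfqrFamily … (sfqrE₄ … μ₁ μ₂ ·))` —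
the (P-R) knit family with ALL FOUR ENTRIES CONCRETE (0 = the η-defect of the glued propagator with Bałaban's whole covariant summand live, 1–2 = covariant forward-gradient defects, 3 = the
`(ΔG)`-defect) and NO displayed row: hypotheses `L ≥ 7` odd, `a > 0`, `c35 > 0`, `he` only.

HONEST FRAMING ∕ LIMITS.  MODEL carriers (one finite torus `𝕋^{d+1}` per index, unit-torus blocks, the knit's exponential transporters read through `cvT₀`); the entries (1)–(3)
remain HYPOTHESES (`hE`); NOT [Balaban1985BackgroundPropagators] (3.49) ∕ Thm 3.4 ∕ Thm 3.14 as printed; NE2⁺ is NOT a printed statement; N15 of record untouched (DISCHARGED AS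
CONSUMED, p687738); counts UNMOVED (typed 28∕28 · discharged 8∕27).
-/

noncomputable section

open scoped BigOperators Matrix
open Finset

namespace Summit.QuantumFields.YangMills.BalabanUVNodes.N15.Gluing

open Literature.MathematicalPhysics.QuantumFieldTheory.Balaban1983to89
open Literature.MathematicalPhysics.QuantumFieldTheory.Balaban1983to89.B5Prop11Plancherel (Tor fine unitVec)
open Literature.MathematicalPhysics.QuantumFieldTheory.Balaban1983to89.B11SectG (BlockNorm HasMaj)
open Literature.MathematicalPhysics.QuantumFieldTheory.Balaban1983to89.B6UnitTorusCarrier (unitTorusGeo unitTorusGeo_dist_nonneg)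
open Literature.MathematicalPhysics.QuantumFieldTheory.Balaban1983to89.T4EtaRateDefect (idef)
open Literature.MathematicalPhysics.QuantumFieldTheory.Balaban1983to89.T4EtaRateCoeffDefect (pull)
open Literature.MathematicalPhysics.QuantumFieldTheory.Balaban1983to89.T4EtaRate (NE2PlusOperator rateFactor)
open Literature.MathematicalPhysics.QuantumFieldTheory.King1986 (aK aK_pos aK_le aK_ge)
open Literature.MathematicalPhysics.QuantumFieldTheory.King1986.Torus (blockOf tdistT)
open Literature.Barriers.QuantumFields (traceForm)
open Summit.QuantumFields.YangMills.BalabanUVNodes.N15.MatrixSpecies (liftBlk liftMap basisConst basisConst_nonneg)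
open Summit.QuantumFields.YangMills.BalabanUVNodes.N15.BackgroundLayer (gavgM)
open Summit.QuantumFields.YangMills.BalabanUVNodes.N15.VectorPiece (kingPr kingPrV tensorId bshiftEquiv bshiftEquiv_apply bshiftEquiv_symm_apply)
open Summit.QuantumFields.YangMills.BalabanUVNodes.N15.OperatorReadout (opGeo)
open Summit.QuantumFields.YangMills.BalabanUVNodes.N15.CovLandau (cgrad csavg cGreen cSop landauCov bBack landauSmallConst cXL cYL cAL cPL)
open Summit.QuantumFields.YangMills.BalabanUVNodes.N15.CurvedSpecies (exp_smul_unitary_of_conjTranspose)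
open Summit.QuantumFields.YangMills.BalabanUVNodes.N15.TwoGrid (landauRe)

variable {d : ℕ} {L : ℕ} [NeZero L]

/-- King's couplings at two scales differ by an η-small amount: `|a_{r+k} − a_k| ≤ 2·(L^k)⁻¹` for `L ≥ 2`, `k ≥ 1` (`a_K = (1 − L⁻²)∕(1 − L^{−2K})`).
[cite: King1986, (2.13) p.653, (2.16) p.653] -/
theorem abs_aK_add_sub_aK_le {x : ℝ} (hx : 2 ≤ x) {k : ℕ} (hk : 1 ≤ k) (r : ℕ) :
    |aK 1 x (r + k) - aK 1 x k| ≤ 2 * (x ^ k)⁻¹ := by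
  have hx1 : 1 < x := by linarith
  have hx0 : 0 < x := by linarith
  have hc0 : 0 < 1 - (x ^ 2)⁻¹ := by
    have h4 : (4 : ℝ) ≤ x ^ 2 := by nlinarith
    have : (x ^ 2)⁻¹ ≤ 1 / 4 := by rw [one_div]; exact inv_anti₀ (by norm_num) h4
    linarith
  have hc1 : 1 - (x ^ 2)⁻¹ ≤ 1 := by have : 0 ≤ (x ^ 2)⁻¹ := by positivity
                                     linarith
  have hxk1 : 1 ≤ x ^ k := one_le_pow₀ hx1.le
  have hxk2 : (2 : ℝ) ≤ x ^ k := by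
    calc (2 : ℝ) ≤ x := hx
      _ = x ^ 1 := (pow_one x).symm
      _ ≤ x ^ k := pow_le_pow_right₀ hx1.le hk
  -- the two small numbers `u = L^{-2k}`, `v = L^{-2(r+k)}`
  have hu : (x ^ (2 * k))⁻¹ = (x ^ k)⁻¹ * (x ^ k)⁻¹ := by rw [← mul_inv, ← pow_add]; ring_nf
  have hik0 : 0 < (x ^ k)⁻¹ := by positivity
  have hik : (x ^ k)⁻¹ ≤ 1 / 2 := by rw [one_div]; exact inv_anti₀ (by norm_num) hxk2
  have hu0 : 0 ≤ (x ^ (2 * k))⁻¹ := by positivity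
  have hu4 : (x ^ (2 * k))⁻¹ ≤ 1 / 4 := by rw [hu]; nlinarith
  have hv0 : 0 ≤ (x ^ (2 * (r + k)))⁻¹ := by positivity
  have hvu : (x ^ (2 * (r + k)))⁻¹ ≤ (x ^ (2 * k))⁻¹ := inv_anti₀ (by positivity) (pow_le_pow_right₀ hx1.le (by omega))
  have hden : 0 < 1 - (x ^ (2 * k))⁻¹ := by linarith
  have hden' : 0 < 1 - (x ^ (2 * (r + k)))⁻¹ := by linarith
  have e1 : aK 1 x (r + k) - aK 1 x k = (1 - (x ^ 2)⁻¹) * ((x ^ (2 * (r + k)))⁻¹ - (x ^ (2 * k))⁻¹) / ((1 - (x ^ (2 * (r + k)))⁻¹) * (1 - (x ^ (2 * k))⁻¹)) := by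
    unfold aK
    rw [div_sub_div _ _ hden'.ne' hden.ne']
    congr 1
    ring
  rw [e1, abs_div, abs_mul, abs_of_pos hc0, abs_of_nonpos (by linarith), abs_of_pos (mul_pos hden' hden), div_le_iff₀ (mul_pos hden' hden)]
  -- `c·(u − v) ≤ u ≤ (L^k)⁻¹/2 ≤ 2·(L^k)⁻¹·((1−v)(1−u))`
  have h1 : (1 - (x ^ 2)⁻¹) * -((x ^ (2 * (r + k)))⁻¹ - (x ^ (2 * k))⁻¹) ≤ (x ^ (2 * k))⁻¹ := by
    have t1 : (1 - (x ^ 2)⁻¹) * -((x ^ (2 * (r + k)))⁻¹ - (x ^ (2 * k))⁻¹) ≤ (1 - (x ^ 2)⁻¹) * (x ^ (2 * k))⁻¹ :=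
      mul_le_mul_of_nonneg_left (by linarith) hc0.le
    have t2 : (1 - (x ^ 2)⁻¹) * (x ^ (2 * k))⁻¹ ≤ 1 * (x ^ (2 * k))⁻¹ := mul_le_mul_of_nonneg_right hc1 hu0
    linarith
  have h2 : (3 / 4 : ℝ) * (3 / 4) ≤ (1 - (x ^ (2 * (r + k)))⁻¹) * (1 - (x ^ (2 * k))⁻¹) := mul_le_mul (by linarith) (by linarith) (by norm_num) (by linarith)
  have h3 : (x ^ (2 * k))⁻¹ ≤ (x ^ k)⁻¹ * (1 / 2) := by rw [hu]; exact mul_le_mul_of_nonneg_left hik hik0.le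
  calc (1 - (x ^ 2)⁻¹) * -((x ^ (2 * (r + k)))⁻¹ - (x ^ (2 * k))⁻¹) ≤ (x ^ (2 * k))⁻¹ := h1
    _ ≤ (x ^ k)⁻¹ * (1 / 2) := h3
    _ ≤ (x ^ k)⁻¹ * (2 * ((1 - (x ^ (2 * (r + k)))⁻¹) * (1 - (x ^ (2 * k))⁻¹))) := mul_le_mul_of_nonneg_left (by linarith) hik0.le
    _ = 2 * (x ^ k)⁻¹ * ((1 - (x ^ (2 * (r + k)))⁻¹) * (1 - (x ^ (2 * k))⁻¹)) := by ring

section Node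

open scoped Matrix.Norms.L2Operator

variable (d) (mm ι : Type) [Fintype mm] [DecidableEq mm] [Nonempty mm] [Fintype ι] [DecidableEq ι] (e : Matrix mm mm ℂ ≃L[ℝ] (ι → ℝ))

set_option maxHeartbeats 4000000 in
/-- ★★★ **THE LANDAU-DEFECT ROW `hD` OF n15-c∕234 IS A THEOREM**: the two-grid η-defect row of the Landau letter `N_V^R` at the knit's exponential transporters, at EVERY index of the
family and every class field `A′ ∈ (3.35)`, with ONE constant block `(δ_D, C_R, γ_R, a_D) = (3δ∕16, max 0 K, 1∕4, 1∕(c35·Θ))` (n15-c∕256 at every index, dag-n15-a's flat rows Ξ-6,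
King's mass windows and `abs_aK_add_sub_aK_le`, (3.35)'s sizes Frobenius ⟹ operator, the index-free smallness threshold `Θ`; `K` index-free, obtained by unification).
[cite: Balaban1985BackgroundPropagators, Thm 3.1 (3.42) p.397, (3.35)–(3.37) p.396, (3.49) p.399, Thm 3.4 p.400, Lemma 3.3 p.402, Thm 3.14 pp.426–427; Balaban1984PropagatorsII, Props. 2.2–2.3
pp.228–231; Balaban1983RegularityDecay, Theorem (1.10) p.573; King1986, Thm 3.3 p.656, Prop. 3.9 (3.73) p.665, (2.13)–(2.16) p.653] -/
theorem landauDefectRow_sfqr (hL : Odd L ∧ 1 < L) (hL7 : 7 ≤ L) {a : ℝ} (ha : 0 < a) {c35 : ℝ} (hc35 : 0 < c35) :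
    ∃ δD CR γR aD : ℝ, 0 < δD ∧ 0 ≤ CR ∧ 0 < γR ∧ 0 < aD ∧
      ∀ i : SfIdx d L, ∀ α₀ : ℝ, 0 < α₀ → (L : ℝ) ^ i.m * α₀ ≤ aD → ∀ A' : Fin (d + 1) → CvX' d L i.m i.kk i.r hL → Matrix mm mm ℂ, (sfInstance d mm ι hL i).Bf.Reg335 c35 α₀ A' →
        HasMaj (CvNorm d L i.m i.kk hL ι) (BlockNorm.ofBlocks (unitTorusGeo L i.kk (cvM d L i.m i.kk hL)) (liftBlk (cvBlk d L i.m i.kk hL ∘ (kingPrV L i.kk i.r (cvM d L i.m i.kk hL))) ι)) (idef (pull (liftMap (kingPrV L i.kk i.r (cvM d L i.m i.kk hL)) ι)) (pull (liftMap (kingPrV L i.kk i.r (cvM d L i.m i.kk hL)) ι)) (cvNVr' d L i.m i.kk i.r hL a ι e (fun μ x' => NormedSpace.exp (((((L ^ i.r * L ^ i.kk : ℕ) : ℝ))⁻¹) • A' μ x'))) (cvNVr d L i.m i.kk hL a ι e (fun μ x => NormedSpace.exp (((((L ^ i.kk : ℕ) : ℝ))⁻¹) • gavgM (Matrix mm mm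 ℂ) (Fin (d + 1)) (kingPrV L i.kk i.r (cvM d L i.m i.kk hL)) A' μ x))))
          (fun y y' => (CR * ((L : ℝ) ^ i.kk) ^ (-γR)) * Real.exp (-(δD * (unitTorusGeo L i.kk (cvM d L i.m i.kk hL)).dist y y'))) := by
  have hL2 : 2 ≤ L := le_trans (by norm_num) hL7
  have hLpos : 0 < L := by omega
  have hL1r : (1 : ℝ) < (L : ℝ) := by exact_mod_cast hL.2
  have hLr : (0 : ℝ) < (L : ℝ) := by linarith
  have hL2r : (2 : ℝ) ≤ (L : ℝ) := by exact_mod_cast hL2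
  -- the fourteen flat rows at every index, one constant block (dag-n15-a Ξ-6), rate exponent `γ = 1∕4`
  obtain ⟨C, δ, CS, hC, hδ, hCS, HF⟩ := flatRowsAll_sfIdx d ι hL hL7 (γ := (1 / 4 : ℝ)) (by norm_num) (by norm_num)
  -- the index-free constants of n15-c∕256 and the smallness threshold `Θ`
  have hκF := @basisConst_nonneg ι _ (Matrix mm mm ℂ) Matrix.frobeniusNormedAddCommGroup Matrix.frobeniusNormedSpace e
  obtain ⟨κm, hκmdef⟩ : ∃ x : ℝ, x = (@basisConst ι _ (Matrix mm mm ℂ) Matrix.frobeniusNormedAddCommGroup Matrix.frobeniusNormedSpace e * (2 * Real.sqrt (Fintype.card mm)) * Real.sqrt (Fintype.card mm)) := ⟨_, rfl⟩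
  have hκm : 0 ≤ κm := by rw [hκmdef]; positivity
  obtain ⟨Cρ, hCρdef⟩ : ∃ x : ℝ, x = 2 * Fintype.card ι * κm := ⟨_, rfl⟩
  have hCρ : 0 ≤ Cρ := by rw [hCρdef]; positivity
  obtain ⟨Cl, hCldef⟩ : ∃ x : ℝ, x = Real.exp 1 * Fintype.card ι * κm := ⟨_, rfl⟩
  have hCl : 0 ≤ Cl := by rw [hCldef]; positivity
  obtain ⟨c8, hc8def⟩ : ∃ x : ℝ, x = (B4Sect5Proof.latticeConst (d + 1) (δ / 8)) := ⟨_, rfl⟩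
  have hc8 : 0 ≤ c8 := by rw [hc8def]; exact B4Sect5Proof.latticeConst_nonneg (d + 1) (by positivity)
  obtain ⟨c32, hc32def⟩ : ∃ x : ℝ, x = (B4Sect5Proof.latticeConst (d + 1) (δ / 2 / 16)) := ⟨_, rfl⟩
  have hc32 : 0 ≤ c32 := by rw [hc32def]; exact B4Sect5Proof.latticeConst_nonneg (d + 1) (by positivity)
  obtain ⟨c2, hc2def⟩ : ∃ x : ℝ, x = (B4Sect5Proof.latticeConst (d + 1) (3 * δ / 160)) := ⟨_, rfl⟩
  have hc2 : 0 ≤ c2 := by rw [hc2def]; exact B4Sect5Proof.latticeConst_nonneg (d + 1) (by positivity)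
  obtain ⟨SL, hSLdef⟩ : ∃ x : ℝ, x = 2 * cXL ((d : ℝ) + 1) C C Cρ Cl (2 * ((d : ℝ) + 1) * Cρ) 1 c8 δ (δ / 8) * c8 + 2 * cYL ((d : ℝ) + 1) C Cρ c8 δ * c8 + 2 * ((d : ℝ) + 1) * Cρ := ⟨_, rfl⟩
  have hSL : 0 ≤ SL := by rw [hSLdef]; unfold cXL cYL; positivity
  obtain ⟨S2, hS2def⟩ : ∃ x : ℝ, x = landauSmallConst ((d : ℝ) + 1) (Fintype.card ι) C C C CS (cPL ((d : ℝ) + 1) C C Cρ Cl (2 * ((d : ℝ) + 1) * Cρ) 1 c8 δ (δ / 8)) Cρ (2 * ((d : ℝ) + 1) * Cρ) 1 c32 (δ / 2) := ⟨_, rfl⟩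
  have hS2 : 0 ≤ S2 := by rw [hS2def]; unfold landauSmallConst CovLandau.cK1 CovLandau.cB0 CovLandau.cM2 CovLandau.cPG0 CovLandau.cA0 cPL cAL cYL; positivity
  obtain ⟨KX2, hKX2def⟩ : ∃ x : ℝ, x = cXL ((d : ℝ) + 1) C C Cρ Cl (2 * ((d : ℝ) + 1) * Cρ) 1 c2 (3 * δ / 8) (3 * δ / 160) * c2 := ⟨_, rfl⟩
  have hKX2 : 0 ≤ KX2 := by rw [hKX2def]; unfold cXL; positivity
  obtain ⟨ZC, hZCdef⟩ : ∃ x : ℝ, x = ((d : ℝ) + 1) * Cρ * (C + C) * c2 := ⟨_, rfl⟩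
  have hZC : 0 ≤ ZC := by rw [hZCdef]; positivity
  obtain ⟨Θ, hΘdef⟩ : ∃ x : ℝ, x = 2 + ((d : ℝ) + 1) * Cρ + SL + S2 + 2 * KX2 + 2 * ZC + 1 := ⟨_, rfl⟩
  have hΘ : 0 < Θ := by rw [hΘdef]; positivity
  obtain ⟨aD, haDdef⟩ : ∃ x : ℝ, x = 1 / (c35 * Θ) := ⟨_, rfl⟩
  have haD : 0 < aD := by rw [haDdef]; positivity
  -- ★ the η-defect row `hD` at every index with ONE index-free constant `K` (n15-c∕256 at `M := cvM`, `S := (L^k)^{-1/4}`; `K` by unification)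
  have HK : ∃ K : ℝ, ∀ i : SfIdx d L, ∀ α₀ : ℝ, 0 < α₀ → (L : ℝ) ^ i.m * α₀ ≤ aD →
      ∀ A' : Fin (d + 1) → CvX' d L i.m i.kk i.r hL → Matrix mm mm ℂ, (sfInstance d mm ι hL i).Bf.Reg335 c35 α₀ A' →
        HasMaj (CvNorm d L i.m i.kk hL ι) (BlockNorm.ofBlocks (unitTorusGeo L i.kk (cvM d L i.m i.kk hL)) (liftBlk (cvBlk d L i.m i.kk hL ∘ (kingPrV L i.kk i.r (cvM d L i.m i.kk hL))) ι)) (idef (pull (liftMap (kingPrV L i.kk i.r (cvM d L i.m i.kk hL)) ι)) (pull (liftMap (kingPrV L i.kk i.r (cvM d L i.m i.kk hL)) ι)) (cvNVr' d L i.m i.kk i.r hL a ι e (fun μ x' => NormedSpace.exp (((((L ^ i.r * L ^ i.kk : ℕ) : ℝ))⁻¹) • A' μ x'))) (cvNVr d L i.m i.kk hL a ι e (fun μ x => NormedSpace.exp (((((L ^ i.kk : ℕ) : ℝ))⁻¹) • gavgM (Matrix mm mm ℂ) (Fin (d + 1)) (kingPrV L i.kk i.r (cvM d L i.m i.kk hL))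 A' μ x))))
          (fun y y' => ((L : ℝ) ^ i.kk) ^ (-(1 / 4 : ℝ)) * K * Real.exp (-((3 * δ / 16) * tdistT (cvM d L i.m i.kk hL) y y'))) := by
    refine ⟨?_, fun i α₀ hα₀ hMa A' hA' => ?_⟩
    swap
    · have hK1 : 1 ≤ i.kk := i.one_le
      have hK2 : 1 ≤ i.r + i.kk := hK1.trans (Nat.le_add_left _ _)
      obtain ⟨⟨_, haKhi, _, haKhi'⟩, r1, r2, r3, r4, r5, r6, r7, r8, r9, r10, r11, r12, r13, r14⟩ := HF i
      obtain ⟨hskew, h1F, h2F, h3F⟩ := (sfInstance_reg335_iff d mm ι hL i c35 α₀ A').1 hA'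
      -- scalars at the index
      have hn0 : (0 : ℝ) < (((L ^ i.kk : ℕ) : ℝ)) := by exact_mod_cast pow_pos hLpos _
      have hn'0 : (0 : ℝ) < (((L ^ i.r * L ^ i.kk : ℕ) : ℝ)) := by exact_mod_cast Nat.mul_pos (pow_pos hLpos _) (pow_pos hLpos _)
      have hx1 : (1 : ℝ) ≤ (L : ℝ) ^ i.kk := one_le_pow₀ hL1r.le
      have hx0 : (0 : ℝ) < (L : ℝ) ^ i.kk := pow_pos hLr _
      have hcast : (((L ^ i.kk : ℕ) : ℝ)) = (L : ℝ) ^ i.kk := by push_cast; rfl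
      have hconv : ((L : ℝ) ^ i.kk)⁻¹ * ((L : ℝ) ^ i.r)⁻¹ = ((((L ^ i.r * L ^ i.kk : ℕ) : ℝ)))⁻¹ := by
        push_cast
        rw [mul_inv, mul_comm]
      have hS0 : (0 : ℝ) ≤ ((L : ℝ) ^ i.kk) ^ (-(1 / 4 : ℝ)) := Real.rpow_nonneg hx0.le _
      have hinvθ : ((L : ℝ) ^ i.kk)⁻¹ ≤ ((L : ℝ) ^ i.kk) ^ (-(1 / 4 : ℝ)) := by
        rw [← Real.rpow_neg_one]
        exact Real.rpow_le_rpow_of_exponent_le hx1 (by norm_num)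
      have hnS : ((((L ^ i.kk : ℕ) : ℝ)))⁻¹ ≤ ((L : ℝ) ^ i.kk) ^ (-(1 / 4 : ℝ)) := by rw [hcast]; exact hinvθ
      have hεθ : (0 : ℝ) ≤ C * ((L : ℝ) ^ i.kk) ^ (-(1 / 4 : ℝ)) := mul_nonneg hC.le hS0
      -- King's masses
      have haw0 : 0 < aK 1 (L : ℝ) i.kk := aK_pos one_pos hL1r hK1
      have haw0' : 0 < aK 1 (L : ℝ) (i.r + i.kk) := aK_pos one_pos hL1r hK2
      have haw : |aK 1 (L : ℝ) (i.r + i.kk) - aK 1 (L : ℝ) i.kk| ≤ 2 * ((L : ℝ) ^ i.kk) ^ (-(1 / 4 : ℝ)) :=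
        (abs_aK_add_sub_aK_le hL2r hK1 i.r).trans (mul_le_mul_of_nonneg_left hinvθ (by norm_num))
      -- (3.35)'s sizes in the operator norm: `‖A′‖ ≤ r`, `‖∇A′‖ ≤ r∕n′`, `‖∇∇A′‖ ≤ r∕n′²`
      have hr0 : 0 ≤ (c35 * (L : ℝ) ^ i.m * α₀) := by positivity
      have h1 : ∀ μ x', ‖A' μ x'‖ ≤ (c35 * (L : ℝ) ^ i.m * α₀) := fun μ x' => (l2_opNorm_le_frobenius_norm _).trans (h1F μ x')
      have h2 : ∀ μ κ b', ‖A' μ (bshiftEquiv (cvM d L i.m i.kk hL) (L ^ i.r * L ^ i.kk) κ b') - A' μ b'‖ ≤ (c35 * (L : ℝ) ^ i.m * α₀) * (((((L ^ i.r * L ^ i.kk : ℕ) : ℝ)))⁻¹) :=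
        fun μ κ x' => ((l2_opNorm_le_frobenius_norm _).trans (h2F μ κ x')).trans_eq (by rw [hconv])
      have h3' : ∀ μ κ x', ‖(A' μ (bshiftEquiv (cvM d L i.m i.kk hL) (L ^ i.r * L ^ i.kk) κ x') - A' μ x') -
          (A' μ (bshiftEquiv (cvM d L i.m i.kk hL) (L ^ i.r * L ^ i.kk) κ ((bshiftEquiv (cvM d L i.m i.kk hL) (L ^ i.r * L ^ i.kk) μ).symm x')) - A' μ ((bshiftEquiv (cvM d L i.m i.kk hL) (L ^ i.r * L ^ i.kk) μ).symm x'))‖ ≤ (c35 * (L : ℝ) ^ i.m * α₀) * (((((L ^ i.r * L ^ i.kk : ℕ) : ℝ)))⁻¹) * (((((L ^ i.r * L ^ i.kk : ℕ) : ℝ)))⁻¹) :=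
        fun μ κ x' => ((l2_opNorm_le_frobenius_norm _).trans (h3F μ κ x')).trans_eq (by rw [hconv])
      have h3 : ∀ μ κ (b' : CvX' d L i.m i.kk i.r hL),
          ‖(fun b : CvX' d L i.m i.kk i.r hL => (((L ^ i.r * L ^ i.kk : ℕ) : ℝ)) • (A' μ b - A' μ (b.1 - unitVec (fine (L ^ i.r * L ^ i.kk) (cvM d L i.m i.kk hL)) μ, b.2))) (bshiftEquiv (cvM d L i.m i.kk hL) (L ^ i.r * L ^ i.kk) κ b') -
            (fun b : CvX' d L i.m i.kk i.r hL => (((L ^ i.r * L ^ i.kk : ℕ) : ℝ)) • (A' μ b - A' μ (b.1 - unitVec (fine (L ^ i.r * L ^ i.kk) (cvM d L i.m i.kk hL)) μ, b.2))) b'‖ ≤ (c35 * (L : ℝ) ^ i.m * α₀) * (((((L ^ i.r * L ^ i.kk : ℕ) : ℝ)))⁻¹) := by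
        intro μ κ b'
        have h := h3' μ κ b'
        have hpt : bshiftEquiv (cvM d L i.m i.kk hL) (L ^ i.r * L ^ i.kk) κ ((bshiftEquiv (cvM d L i.m i.kk hL) (L ^ i.r * L ^ i.kk) μ).symm b') = ((bshiftEquiv (cvM d L i.m i.kk hL) (L ^ i.r * L ^ i.kk) κ b').1 - unitVec (fine (L ^ i.r * L ^ i.kk) (cvM d L i.m i.kk hL)) μ, (bshiftEquiv (cvM d L i.m i.kk hL) (L ^ i.r * L ^ i.kk) κ b').2) := by
          rw [bshiftEquiv_symm_apply, bshiftEquiv_apply, bshiftEquiv_apply]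
          exact Prod.ext (sub_add_eq_add_sub _ _ _) rfl
        rw [hpt, bshiftEquiv_symm_apply] at h
        show ‖(((L ^ i.r * L ^ i.kk : ℕ) : ℝ)) • (A' μ (bshiftEquiv (cvM d L i.m i.kk hL) (L ^ i.r * L ^ i.kk) κ b') - A' μ ((bshiftEquiv (cvM d L i.m i.kk hL) (L ^ i.r * L ^ i.kk) κ b').1 - unitVec (fine (L ^ i.r * L ^ i.kk) (cvM d L i.m i.kk hL)) μ, (bshiftEquiv (cvM d L i.m i.kk hL) (L ^ i.r * L ^ i.kk) κ b').2)) -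
            (((L ^ i.r * L ^ i.kk : ℕ) : ℝ)) • (A' μ b' - A' μ (b'.1 - unitVec (fine (L ^ i.r * L ^ i.kk) (cvM d L i.m i.kk hL)) μ, b'.2))‖ ≤ (c35 * (L : ℝ) ^ i.m * α₀) * (((((L ^ i.r * L ^ i.kk : ℕ) : ℝ)))⁻¹)
        rw [← smul_sub, norm_smul, Real.norm_of_nonneg hn'0.le, sub_sub_sub_comm]
        calc (((L ^ i.r * L ^ i.kk : ℕ) : ℝ)) * _ ≤ (((L ^ i.r * L ^ i.kk : ℕ) : ℝ)) * ((c35 * (L : ℝ) ^ i.m * α₀) * (((((L ^ i.r * L ^ i.kk : ℕ) : ℝ)))⁻¹) * (((((L ^ i.r * L ^ i.kk : ℕ) : ℝ)))⁻¹)) := mul_le_mul_of_nonneg_left h hn'0.le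
          _ = (c35 * (L : ℝ) ^ i.m * α₀) * (((((L ^ i.r * L ^ i.kk : ℕ) : ℝ)))⁻¹) * ((((L ^ i.r * L ^ i.kk : ℕ) : ℝ)) * ((((L ^ i.r * L ^ i.kk : ℕ) : ℝ)))⁻¹) := by ring
          _ = (c35 * (L : ℝ) ^ i.m * α₀) * (((((L ^ i.r * L ^ i.kk : ℕ) : ℝ)))⁻¹) := by rw [mul_inv_cancel₀ hn'0.ne', mul_one]
      -- unitarity of the exponential transporters; the Landau letters are free of the mass (n15-c∕210)
      have hU' : ∀ ν (p : CvX' d L i.m i.kk i.r hL), ((fun μ x' => NormedSpace.exp (((((L ^ i.r * L ^ i.kk : ℕ) : ℝ))⁻¹) • A' μ x')) ν p)ᴴ * (fun μ x' => NormedSpace.exp (((((L ^ i.r * L ^ i.kk : ℕ) : ℝ))⁻¹) • A' μ x')) ν p = 1 := fun ν p => exp_smul_unitary_of_conjTranspose (hskew ν p) _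
      have hĀs : ∀ μ p, (gavgM (Matrix mm mm ℂ) (Fin (d + 1)) (kingPrV L i.kk i.r (cvM d L i.m i.kk hL)) A' μ p)ᴴ = -gavgM (Matrix mm mm ℂ) (Fin (d + 1)) (kingPrV L i.kk i.r (cvM d L i.m i.kk hL)) A' μ p := fun μ p => gavgM_conjTranspose_of_skew (kingPrV L i.kk i.r (cvM d L i.m i.kk hL)) hskew μ p
      have hU : ∀ ν (p : CvX d L i.m i.kk hL), ((fun μ x => NormedSpace.exp (((((L ^ i.kk : ℕ) : ℝ))⁻¹) • gavgM (Matrix mm mm ℂ) (Fin (d + 1)) (kingPrV L i.kk i.r (cvM d L i.m i.kk hL)) A' μ x)) ν p)ᴴ * (fun μ x => NormedSpace.exp (((((L ^ i.kk : ℕ) : ℝ))⁻¹) • gavgM (Matrix mm mm ℂ) (Fin (d + 1)) (kingPrV L i.kk i.r (cvM d L i.m i.kk hL)) A' μ x)) ν p = 1 := fun ν p => exp_smul_unitary_of_conjTranspose (hĀs ν p) _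
      have hT' : ∀ ν x, IsUnit (cvT₀ e (fun μ x' => NormedSpace.exp (((((L ^ i.r * L ^ i.kk : ℕ) : ℝ))⁻¹) • A' μ x')) ν x) := fun ν x => isUnit_cvT₀ e hU' ν x
      have hT : ∀ ν x, IsUnit (cvT₀ e (fun μ x => NormedSpace.exp (((((L ^ i.kk : ℕ) : ℝ))⁻¹) • gavgM (Matrix mm mm ℂ) (Fin (d + 1)) (kingPrV L i.kk i.r (cvM d L i.m i.kk hL)) A' μ x)) ν x) := fun ν x => isUnit_cvT₀ e hU ν x
      have efine : cvNVr' d L i.m i.kk i.r hL a ι e (fun μ x' => NormedSpace.exp (((((L ^ i.r * L ^ i.kk : ℕ) : ℝ))⁻¹) • A' μ x')) =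
          Matrix.mulVecLin (landauCov (cvM d L i.m i.kk hL) (L ^ i.r * L ^ i.kk) (cvT₀ e (fun μ x' => NormedSpace.exp (((((L ^ i.r * L ^ i.kk : ℕ) : ℝ))⁻¹) • A' μ x'))) (aK 1 (L : ℝ) (i.r + i.kk) * (((L ^ i.r * L ^ i.kk : ℕ) : ℝ)) ^ (d + 1))) - tensorId ι (landauRe (cvM d L i.m i.kk hL) (L ^ i.r * L ^ i.kk)) := by
        rw [cvNVr', cvLandau', CovLandau.landauCov_eq_of_mass _ _ hT' ha (mul_pos haw0' (pow_pos hn'0 _))]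
      have ecoarse : cvNVr d L i.m i.kk hL a ι e (fun μ x => NormedSpace.exp (((((L ^ i.kk : ℕ) : ℝ))⁻¹) • gavgM (Matrix mm mm ℂ) (Fin (d + 1)) (kingPrV L i.kk i.r (cvM d L i.m i.kk hL)) A' μ x)) =
          Matrix.mulVecLin (landauCov (cvM d L i.m i.kk hL) (L ^ i.kk) (cvT₀ e (fun μ x => NormedSpace.exp (((((L ^ i.kk : ℕ) : ℝ))⁻¹) • gavgM (Matrix mm mm ℂ) (Fin (d + 1)) (kingPrV L i.kk i.r (cvM d L i.m i.kk hL)) A' μ x))) (aK 1 (L : ℝ) i.kk * (((L ^ i.kk : ℕ) : ℝ)) ^ (d + 1))) - tensorId ι (landauRe (cvM d L i.m i.kk hL) (L ^ i.kk)) := by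
        rw [cvNVr, cvLandau, CovLandau.landauCov_eq_of_mass _ _ hT ha (mul_pos haw0 (pow_pos hn0 _))]
      -- the smallness `r·Θ ≤ 1` from the window `L^m·α₀ ≤ a_D`
      have hthr : (c35 * (L : ℝ) ^ i.m * α₀) * Θ ≤ 1 := by
        calc (c35 * (L : ℝ) ^ i.m * α₀) * Θ = c35 * ((L : ℝ) ^ i.m * α₀) * Θ := by ring
          _ ≤ c35 * aD * Θ := mul_le_mul_of_nonneg_right (mul_le_mul_of_nonneg_left hMa hc35.le) hΘ.le
          _ = 1 := by rw [haDdef]; field_simp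
      have hsmall : (c35 * (L : ℝ) ^ i.m * α₀) * (2 + ((d : ℝ) + 1) * (2 * Fintype.card ι * κm) + (2 * cXL ((d : ℝ) + 1) C C (2 * Fintype.card ι * κm) (Real.exp 1 * Fintype.card ι * κm) (2 * ((d : ℝ) + 1) * (2 * Fintype.card ι * κm)) 1 (B4Sect5Proof.latticeConst (d + 1) (δ / 8)) δ (δ / 8) * (B4Sect5Proof.latticeConst (d + 1) (δ / 8)) + 2 * cYL ((d : ℝ) + 1) C (2 * Fintype.card ι * κm) (B4Sect5Proof.latticeConst (d + 1) (δ / 8)) δ * (B4Sect5Proof.latticeConst (d + 1) (δ / 8)) + (2 * ((d : ℝ) + 1) * (2 * Fintype.card ι * κm))) + (landauSmallConst ((d : ℝ) + 1) (Fintype.card ι) C C C CS (cPL ((d : ℝ) + 1) C C (2 * Fintype.card ι * κm) (Real.exp 1 * Fintype.card ι * κm) (2 * ((d : ℝ) + 1) * (2 * Fintype.card ι * κm)) 1 (B4Sect5Proof.latticeConst (d + 1) (δ / 8)) δ (δ / 8)) (2 * Fintype.card ι * κm) (2 * ((d : ℝ) + 1) * (2 * Fintype.card ι * κm)) 1 (B4Sect5Proof.latticeConst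 (d + 1) (δ / 2 / 16)) (δ / 2)) + 2 * (cXL ((d : ℝ) + 1) C C (2 * Fintype.card ι * κm) (Real.exp 1 * Fintype.card ι * κm) (2 * ((d : ℝ) + 1) * (2 * Fintype.card ι * κm)) 1 (B4Sect5Proof.latticeConst (d + 1) (3 * δ / 160)) (3 * δ / 8) (3 * δ / 160) * (B4Sect5Proof.latticeConst (d + 1) (3 * δ / 160))) + 2 * (((d : ℝ) + 1) * (2 * Fintype.card ι * κm) * (C + C) * (B4Sect5Proof.latticeConst (d + 1) (3 * δ / 160))) + 1) ≤ 1 := by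
        have h := hthr
        rw [hΘdef, hSLdef, hS2def, hKX2def, hZCdef, hCldef, hCρdef, hc8def, hc32def, hc2def] at h
        exact h
      -- n15-c∕256 at the index
      rw [← liftBlk_blockOf_fine_eq, efine, ecoarse]
      exact hasMaj_idef_landauCov_sub_landauRe_exp (cvM d L i.m i.kk hL) i.kk i.r e hskew hr0 h1 hκmdef h2 h3 haw0 haKhi haw0' haKhi' hδ hC.le hC.le hC.le hC.le hCS.le
        hεθ hεθ hεθ hεθ hC.le (by norm_num : (0 : ℝ) ≤ 2) hS0 hnS le_rfl le_rfl le_rfl le_rfl haw r1 r3 r2 r13 r4 r5 r7 r6 r14 r8 r9 r11 r10 r12 hsmall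
  obtain ⟨K, HK⟩ := HK
  refine ⟨3 * δ / 16, max 0 K, 1 / 4, aD, by positivity, le_max_left _ _, by norm_num, haD, fun i α₀ hα₀ hMa A' hA' => ?_⟩
  refine (HK i α₀ hα₀ hMa A' hA').mono fun y y' => ?_
  have hθ : 0 ≤ ((L : ℝ) ^ i.kk) ^ (-(1 / 4 : ℝ)) := Real.rpow_nonneg (pow_nonneg hLr.le _) _
  have hex : 0 ≤ Real.exp (-((3 * δ / 16) * tdistT (cvM d L i.m i.kk hL) y y')) := (Real.exp_pos _).le
  show ((L : ℝ) ^ i.kk) ^ (-(1 / 4 : ℝ)) * K * Real.exp (-((3 * δ / 16) * tdistT (cvM d L i.m i.kk hL) y y')) ≤ (max 0 K * ((L : ℝ) ^ i.kk) ^ (-(1 / 4 : ℝ))) * Real.exp (-((3 * δ / 16) * tdistT (cvM d L i.m i.kk hL) y y'))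
  calc ((L : ℝ) ^ i.kk) ^ (-(1 / 4 : ℝ)) * K * Real.exp (-((3 * δ / 16) * tdistT (cvM d L i.m i.kk hL) y y')) ≤ ((L : ℝ) ^ i.kk) ^ (-(1 / 4 : ℝ)) * max 0 K * Real.exp (-((3 * δ / 16) * tdistT (cvM d L i.m i.kk hL) y y')) := mul_le_mul_of_nonneg_right (mul_le_mul_of_nonneg_left (le_max_right 0 K) hθ) hex
    _ = (max 0 K * ((L : ℝ) ^ i.kk) ^ (-(1 / 4 : ℝ))) * Real.exp (-((3 * δ / 16) * tdistT (cvM d L i.m i.kk hL) y y')) := by ring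

/-- ★★★ **THE NODE THEOREM 234′: `NE2PlusOperator` FOR THE KNIT FAMILY FROM THE ENTRIES (1)–(3) ALONE** — n15-c∕234 `ne2PlusOperator_sfqr_of_defectRow` with its displayed Landau-defect row
`hD` discharged by `landauDefectRow_sfqr`; displayed: ONLY the η-rate rows `hE` of the entries `E i n`, `n = 1, 2, 3` (any entry family `E`).
[cite: Balaban1985BackgroundPropagators, Thm 3.1 (3.42) p.397, (3.49) p.399, Thm 3.4 p.400, Lemma 3.3 p.402, Thm 3.14 pp.426–427; Balaban1984PropagatorsII, Props. 2.2–2.3 pp.228–231;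
Balaban1983RegularityDecay, Theorem (1.10) p.573; King1986, Thm 3.3 p.656, Prop. 3.9 (3.73) p.665] -/
theorem ne2PlusOperator_sfqr_of_entries (hL : Odd L ∧ 1 < L) (hL7 : 7 ≤ L) {a : ℝ} (ha : 0 < a) {c35 : ℝ} (hc35 : 0 < c35) (he : ∀ A B : Matrix mm mm ℂ, traceForm A B = e A ⬝ᵥ e B)
    (E : ∀ i : SfIdx d L, Fin 4 → (Fin (d + 1) → CvX' d L i.m i.kk i.r hL → Matrix mm mm ℂ) → ((CvX d L i.m i.kk hL × ι → ℝ) →ₗ[ℝ] (CvX' d L i.m i.kk i.r hL × ι → ℝ)))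
    (hE : ∃ M₁ δ₁ a₁ B₁ γ₁ : ℝ, 0 < M₁ ∧ 0 < δ₁ ∧ 0 < a₁ ∧ 0 < B₁ ∧ 0 < γ₁ ∧
      ∀ i : SfIdx d L, M₁ ≤ (L : ℝ) ^ i.m → ∀ α₀ : ℝ, 0 < α₀ → (L : ℝ) ^ i.m * α₀ ≤ a₁ →
        ∀ A' : Fin (d + 1) → CvX' d L i.m i.kk i.r hL → Matrix mm mm ℂ, (sfInstance d mm ι hL i).Bf.Reg335 c35 α₀ A' → ∀ n : Fin 4, n ≠ 0 →
          HasMaj (BlockNorm.ofBlocks (sfGeo d hL i) (liftBlk (cvBlk d L i.m i.kk hL) ι))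
            (BlockNorm.ofBlocks (sfGeo d hL i) (liftBlk (cvBlk d L i.m i.kk hL ∘ kingPrV L i.kk i.r (cvM d L i.m i.kk hL)) ι)) (E i n A')
            (fun y y' => B₁ * B9.pref4 ((opGeo (sfGeo d hL i) (CvX d L i.m i.kk hL × ι) (liftBlk (cvBlk d L i.m i.kk hL) ι)).len y) n * Real.exp (-(δ₁ * (sfGeo d hL i).dist y y')) *
              max (rateFactor (opGeo (sfGeo d hL i) (CvX d L i.m i.kk hL × ι) (liftBlk (cvBlk d L i.m i.kk hL) ι)) γ₁ y)
                (rateFactor (opGeo (sfGeo d hL i) (CvX d L i.m i.kk hL × ι) (liftBlk (cvBlk d L i.m i.kk hL) ι)) γ₁ y'))) :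
    NE2PlusOperator c35 (sfInstance d mm ι hL) (fun i => sfqrFamily d mm ι a e hL i (E i)) :=
  ne2PlusOperator_sfqr_of_defectRow d mm ι e hL hL7 ha hc35 he E hE (landauDefectRow_sfqr d mm ι e hL hL7 ha hc35)

/-- ★★★★ **`NE2PlusOperator` FOR THE (P-R) KNIT FAMILY WITH ALL FOUR ENTRIES CONCRETE AND NO DISPLAYED ROW** — dag-n15-a (♭-8a) `ne2PlusOperator_sfqr₄E_of_defectRow` (entries `sfqrE₄`:
0 = the η-defect of the glued propagator with Bałaban's whole covariant summand `a·Q*(U)Q(U) − D_U(I − R(U))D*_U` live, 1–2 = the covariant forward-gradient defects at `μ₁, μ₂`,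
3 = the `(ΔG)`-defect) with its ONLY displayed row `hD` discharged by `landauDefectRow_sfqr`.  Hypotheses: `L ≥ 7` odd, `a > 0`, `c35 > 0`, the trace-form ∕ basis compatibility `he`.
MODEL carriers; NOT [Balaban1985BackgroundPropagators] Thm 3.1 ∕ 3.4 ∕ 3.14 as printed; NE2⁺ NOT PRINTED.
[cite: Balaban1985BackgroundPropagators, Thm 3.1 (3.42) p.397, (3.35)–(3.37) p.396, (3.49) p.399, Thm 3.4 p.400, Thm 3.14 pp.426–427; King1986, Thm 3.3 p.656, Prop. 3.8 (3.71) p.664,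
Prop. 3.9 (3.73) p.665, (2.13)–(2.16) p.653] -/
theorem ne2PlusOperator_sfqr₄E_closed (hL : Odd L ∧ 1 < L) (hL7 : 7 ≤ L) {a : ℝ} (ha : 0 < a) {c35 : ℝ} (hc35 : 0 < c35) (he : ∀ A B : Matrix mm mm ℂ, traceForm A B = e A ⬝ᵥ e B)
    (μ₁ μ₂ : Fin (d + 1)) :
    NE2PlusOperator c35 (sfInstance d mm ι hL) (fun i => sfqrFamily d mm ι a e hL i (sfqrE₄ d mm ι e hL a μ₁ μ₂ i)) :=
  ne2PlusOperator_sfqr₄E_of_defectRow d mm ι e hL hL7 ha hc35 he μ₁ μ₂ (landauDefectRow_sfqr d mm ι e hL hL7 ha hc35)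

end Node

end Summit.QuantumFields.YangMills.BalabanUVNodes.N15.Gluing

end
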